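import Summits.RiemannHypothesis.RiemannHypothesis.Theorems.Splittings.CostumeDetectorsNbNeg
import HarnessLib

/-!
# Splittings / NB — the `θ = 1/2` doubling tail is decided by a FINITE certificate (reduction lemma)

Cell rh-split, seat rh-split-nb-neg g3 (card `SPLIT-nb-neg.md` §9; g0 census V4/V5, g2 H1(α)).
`D(N) = inf_a ∫ |1 - ζ(1/2+it) Σ_{k<N} a_k (k+1)^{-(1/2+it)}|² dt/(1/4+t²)` (`= 2π d_N²`), spelled raw.

The tree (`Splittings/CostumeDetectorsNbNeg.lean`) settles the doubling (self-improvement) tail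
`∀ N ≥ H, D(N²) ≤ θ·D(N)` on both sides of `θ = 1/2`: REFUTED for every `θ < 1/2`
(`not_nb_doublingTail_of_lt_half`: iterate against the floor `C/log N ≤ D(N) ≤ 2π`), RH ALONE for
every `θ < 1` (`rh_of_nb_doublingTail`).  At `θ = 1/2` exactly — the value the printed asymptotic
`D(N) ~ 2π(2+γ-log 4π)/log N` [BDBLS 2000, conjecture; Burnol 2002 Thm 1.3 for the lower bound]
predicts as the limit ratio — the iteration is neutral (`log N² = 2 log N`) and the tail was left
UNDECIDED.  This file proves that it is decided by ONE finite computation: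

* `two_pi_mul_le_of_frequently_nbRateBound`, `lt_const_of_frequently_nbRateBound` — Burnol's
  transfer needs the rate bound only FREQUENTLY (on an unbounded set of levels), not eventually:
  `(∃ᶠ N, ∃ a, I(N,a) ≤ C/log N) → 0.214 < C` (the tree's 29 certified zero pairs);
* `frequently_rateBound_of_halfDoublingTail` — the `θ = 1/2` tail transports one certificate
  `I(N₀,a₀) ≤ c/log N₀` (`N₀ ≥ max(H,2)`) to the whole tower `N₀^{2^k}`:
  `D(N₀^{2^k}) · log N₀^{2^k} ≤ c` for all `k`, hence `∃ᶠ N, ∃ a, I(N,a) ≤ c'/log N` for every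
  `c' > c`;
* `not_nb_halfDoublingTail_of_certificate` — **`TailDoubling(1/2, H)` is FALSE as soon as one level
  `N₀ ≥ max(H,2)` carries a polynomial with `I(N₀,a₀)·log N₀ ≤ c < 0.214`**; the abstract form
  `not_nb_halfDoublingTail_of_certificate_finset` replaces `0.214` by `2π Σ_{ρ ∈ T} m_ρ²/|ρ|²` over ANY
  finite set `T` of certified critical zeros (full sum: `2π·0.046191 = 0.29023`);
* `nb_levelFloor_of_halfDoublingTail` — contrapositive: the `θ = 1/2` tail forces the per-level
  floor `0.214/log N ≤ I(N,a)` at EVERY level `N ≥ max(H,2)` (an RH-free, checkable prediction).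

PRICE (card §9, numerics are citations not theorems): Landreau–Richard 2002 (p. 3, LS fit over
`n ≤ 2·10⁴`) report `d_n √log n ≈ 0.21377` against the conjectured limit `0.21492`, i.e.
`I_min(N)·log N ≈ 0.287 = 98.9 %` of `0.29023` and INCREASING; a refuting certificate therefore
needs the zero sum certified to `> 98.9 %` of its total (`≈ 10⁴` zeros, height `≈ 10⁴`; the tree
has 58 zeros = `73.8 %`) AND a kernel-certified distance in dimension `≈ 10⁴–10⁵` with a `< 1 %`
margin.  Finite, but two orders of magnitude beyond the tree's validated numerics: the `θ = 1/2`
tail stays UNDECIDED in kernel; what lands is the reduction.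

LABEL (referee rh-split-ref g2, 2026-08-27T00:15Z): `TailDoubling(½, H)` is RH-OR-STRONGER (tree:
`rh_of_nb_doublingTail` gives RH from every `θ < 1` tail); this file is an RH-free REDUCTION / PREDICTION
(the `θ = ½` tail ⟹ a finite certificate is impossible ⟹ a per-level floor), NOT a refutation of the tail.

No definitions; RH-free.  HONEST LABEL: «SPLITTING SEARCH over kernel-typed RH-EQUIVALENCES; a
splitting A ∧ B ⟹ RH is CONDITIONAL bookkeeping unless A and B are both proved; nothing here bears
on the truth of RH.»
-/

noncomputable section

-- D-0017: `Summit.<S>.<S>.…` is the designed namespace of a single-problem summit.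
set_option linter.dupNamespace false

open Complex MeasureTheory Set Filter Topology
open scoped Real ENNReal

namespace Summit.RiemannHypothesis.RiemannHypothesis.Theorems.Splittings.NbHalfDoubling

open Summit.RiemannHypothesis.RiemannHypothesis.Theses.NymanBeurling
open Summit.RiemannHypothesis.RiemannHypothesis.Theorems
open Literature.NumberTheory.LFunctions Literature.Barriers.RiemannHypothesis

/-! ## 1. Burnol's transfer in FREQUENTLY form -/

/-- **Transfer, frequently form.** If for every `ε > 0`, eventually as `λ → 0⁺`,
`(√A - ε)/√log(1/λ) ≤ D(λ)`, and `C` is admissible on an UNBOUNDED set of levels — frequently in `N`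
some length-`N` polynomial has `∫⁻ … ≤ C/log N` — then `2π A ≤ C`. (The tree's
`two_pi_mul_le_of_eventually_nbRateBound` uses its eventual hypothesis only through one large `N`
per `ε`.) [cite: Burnol2002, Thm. 1.3] -/
theorem two_pi_mul_le_of_frequently_nbRateBound {A C : ℝ}
    (hA : ∀ ε : ℝ, 0 < ε → ∀ᶠ lam : ℝ in 𝓝[>] 0,
      ENNReal.ofReal ((Real.sqrt A - ε) / Real.sqrt (Real.log (1 / lam))) ≤ nbDist lam)
    (hC : ∃ᶠ N : ℕ in atTop, ∃ a : Fin N → ℂ, ∫⁻ t : ℝ, ENNReal.ofReal (‖1 - riemannZeta (1 / 2 + t * Complex.I) *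
        ∑ n : Fin N, a n * ((n : ℂ) + 1) ^ (-(1 / 2 + t * Complex.I))‖ ^ 2 / (1 / 4 + t ^ 2)) ≤
      ENNReal.ofReal (C / Real.log N)) :
    2 * π * A ≤ C := by
  -- `C > 0`: at one large `N` the bound meets the BDBLS floor `C₀ / log N`
  have hCpos : 0 < C := by
    obtain ⟨C₀, hC₀, hfloor⟩ := nbIntegrand_lowerBound_two_le
    obtain ⟨N, hN2, a, ha⟩ := ((eventually_ge_atTop 2).and_frequently hC).exists
    have hlog : 0 < Real.log (N : ℝ) :=
      Real.log_pos (by exact_mod_cast Nat.lt_of_lt_of_le one_lt_two hN2)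
    have h := (hfloor N hN2 a).trans ha
    by_contra hle
    push Not at hle
    have h0 : ENNReal.ofReal (C / Real.log N) = 0 :=
      ENNReal.ofReal_of_nonpos (div_nonpos_of_nonpos_of_nonneg hle hlog.le)
    rw [h0, nonpos_iff_eq_zero, ENNReal.ofReal_eq_zero] at h
    exact absurd h (not_le.2 (div_pos hC₀ hlog))
  by_cases hA0 : A ≤ 0
  · nlinarith [Real.pi_pos]
  push Not at hA0
  have key : ∀ ε : ℝ, 0 < ε → ε < Real.sqrt A → 2 * π * (Real.sqrt A - ε) ^ 2 ≤ C := by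
    intro ε hε hεA
    have ht : 0 < Real.sqrt A - ε := by linarith
    have hlam : Tendsto (fun N : ℕ ↦ (N : ℝ)⁻¹) atTop (𝓝[>] 0) :=
      tendsto_inv_atTop_nhdsGT_zero.comp tendsto_natCast_atTop_atTop
    obtain ⟨N, ⟨hN2, hN⟩, a, ha⟩ :=
      (((eventually_ge_atTop 2).and (hlam.eventually (hA ε hε))).and_frequently hC).exists
    rw [one_div, inv_inv] at hN
    have hlog : 0 < Real.log (N : ℝ) :=
      Real.log_pos (by exact_mod_cast Nat.lt_of_lt_of_le one_lt_two hN2)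
    have e : ENNReal.ofReal (2 * π) *
        ENNReal.ofReal ((Real.sqrt A - ε) / Real.sqrt (Real.log N)) ^ 2 =
          ENNReal.ofReal (2 * π * ((Real.sqrt A - ε) ^ 2 / Real.log N)) := by
      rw [← ENNReal.ofReal_pow (div_nonneg ht.le (Real.sqrt_nonneg _)), div_pow,
        Real.sq_sqrt hlog.le, ← ENNReal.ofReal_mul (by positivity)]
    have h1 : ENNReal.ofReal (2 * π * ((Real.sqrt A - ε) ^ 2 / Real.log N)) ≤
        ENNReal.ofReal (C / Real.log N) :=
      calc ENNReal.ofReal (2 * π * ((Real.sqrt A - ε) ^ 2 / Real.log N))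
          = ENNReal.ofReal (2 * π) *
              ENNReal.ofReal ((Real.sqrt A - ε) / Real.sqrt (Real.log N)) ^ 2 := e.symm
        _ ≤ ENNReal.ofReal (2 * π) * nbDist ((N : ℝ)⁻¹) ^ 2 := by gcongr
        _ ≤ _ := two_pi_mul_nbDist_sq_le N a
        _ ≤ ENNReal.ofReal (C / Real.log N) := ha
    rw [ENNReal.ofReal_le_ofReal_iff (div_nonneg hCpos.le hlog.le), mul_div_assoc',
      div_le_div_iff_of_pos_right hlog] at h1
    exact h1
  have hlim : Tendsto (fun ε : ℝ ↦ 2 * π * (Real.sqrt A - ε) ^ 2) (𝓝[>] 0)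
      (𝓝 (2 * π * (Real.sqrt A - 0) ^ 2)) :=
    ((continuous_const.mul ((continuous_const.sub continuous_id).pow 2)).tendsto 0).mono_left
      nhdsWithin_le_nhds
  rw [sub_zero, Real.sq_sqrt hA0.le] at hlim
  refine le_of_tendsto hlim ?_
  filter_upwards [Ioo_mem_nhdsGT (Real.sqrt_pos.2 hA0)] with ε hε
  exact key ε hε.1 hε.2

/-- **Finite-family bound, frequently form.** If `C` is frequently admissible then
`2π Σ_{ρ ∈ T} m_ρ²/|ρ|² ≤ C` for every finite set `T` of critical zeros of `ζ`.
[cite: Burnol2002, Thm. 1.3 and Thm. 5.4] -/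
theorem two_pi_mul_sum_multSq_le_of_frequently_nbRateBound {C : ℝ}
    (hC : ∃ᶠ N : ℕ in atTop, ∃ a : Fin N → ℂ, ∫⁻ t : ℝ, ENNReal.ofReal (‖1 - riemannZeta (1 / 2 + t * Complex.I) *
        ∑ n : Fin N, a n * ((n : ℂ) + 1) ^ (-(1 / 2 + t * Complex.I))‖ ^ 2 / (1 / 4 + t ^ 2)) ≤
      ENNReal.ofReal (C / Real.log N))
    (T : Finset ℂ) (hT : ∀ ρ ∈ T, riemannZeta ρ = 0 ∧ ρ.re = 1 / 2) :
    2 * π * ∑ ρ ∈ T, (riemannZetaZeroOrder ρ : ℝ) ^ 2 / ‖ρ‖ ^ 2 ≤ C :=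
  two_pi_mul_le_of_frequently_nbRateBound
    (fun _ hε ↦ Burnol2002Assembly.eventually_nbDist_ge_of_finset T hT hε) hC

/-- **Every frequently admissible constant exceeds `0.214`** (58 certified zeros,
`exists_finset_zeros_sum_ge`). [cite: Burnol2002, Thm. 1.3] -/
theorem lt_const_of_frequently_nbRateBound {C : ℝ}
    (hC : ∃ᶠ N : ℕ in atTop, ∃ a : Fin N → ℂ, ∫⁻ t : ℝ, ENNReal.ofReal (‖1 - riemannZeta (1 / 2 + t * Complex.I) *
        ∑ n : Fin N, a n * ((n : ℂ) + 1) ^ (-(1 / 2 + t * Complex.I))‖ ^ 2 / (1 / 4 + t ^ 2)) ≤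
      ENNReal.ofReal (C / Real.log N)) :
    (214 : ℝ) / 1000 < C := by
  obtain ⟨G, hG, hsum⟩ := exists_finset_zeros_sum_ge
  have h := two_pi_mul_sum_multSq_le_of_frequently_nbRateBound hC G hG
  nlinarith [Real.pi_gt_d6, hsum, h]

/-! ## 2. The `θ = 1/2` tail transports one certificate to an unbounded set of levels -/

/-- Abstract tower lemma (no definitions): if `D(N²) ≤ D(N)/2` for all `N ≥ H` and
`D(N₀) · log N₀ ≤ c` at one `N₀ ≥ H`, `N₀ ≥ 2`, then `D(N₀^{2^k}) · log N₀^{2^k} ≤ c` for all `k`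
(`log N₀^{2^k} = 2^k log N₀`). [folklore] -/
theorem tower_bound_of_halfDoubling (D : ℕ → ℝ) {H N₀ : ℕ} (hH : H ≤ N₀) (h2 : 2 ≤ N₀) {c : ℝ}
    (h : ∀ N : ℕ, H ≤ N → D (N ^ 2) ≤ 1 / 2 * D N) (h0 : D N₀ * Real.log N₀ ≤ c) (k : ℕ) :
    D (N₀ ^ 2 ^ k) * Real.log ((N₀ ^ 2 ^ k : ℕ) : ℝ) ≤ c := by
  have hpowH : ∀ k : ℕ, H ≤ N₀ ^ 2 ^ k := fun k ↦
    hH.trans (Nat.le_self_pow (pow_ne_zero k two_ne_zero) N₀)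
  have hlog : 0 < Real.log N₀ := Real.log_pos (by exact_mod_cast h2)
  have hiter : ∀ k : ℕ, D (N₀ ^ 2 ^ k) ≤ (1 / 2) ^ k * D N₀ := by
    intro k
    induction k with
    | zero => simp
    | succ k ih =>
      have hstep := h (N₀ ^ 2 ^ k) (hpowH k)
      have e : (N₀ ^ 2 ^ k) ^ 2 = N₀ ^ 2 ^ (k + 1) := by rw [← pow_mul, ← pow_succ]
      rw [e] at hstep
      calc D (N₀ ^ 2 ^ (k + 1)) ≤ 1 / 2 * D (N₀ ^ 2 ^ k) := hstep
        _ ≤ 1 / 2 * ((1 / 2) ^ k * D N₀) := by gcongr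
        _ = (1 / 2) ^ (k + 1) * D N₀ := by ring
  have hlogk : Real.log ((N₀ ^ 2 ^ k : ℕ) : ℝ) = 2 ^ k * Real.log N₀ := by
    rw [Nat.cast_pow, Real.log_pow]; push_cast; ring
  rw [hlogk]
  have h2k : (0 : ℝ) < 2 ^ k := by positivity
  calc D (N₀ ^ 2 ^ k) * (2 ^ k * Real.log N₀)
      ≤ (1 / 2) ^ k * D N₀ * (2 ^ k * Real.log N₀) := by gcongr; exact hiter k
    _ = D N₀ * Real.log N₀ * ((1 / 2) ^ k * 2 ^ k) := by ring
    _ = D N₀ * Real.log N₀ := by rw [← mul_pow]; norm_num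
    _ ≤ c := h0

/-- **The `θ = 1/2` tail makes ONE certificate recur on an unbounded set of levels.** If
`D(N²) ≤ D(N)/2` for all `N ≥ H` and some polynomial of length `N₀ ≥ max(H,2)` has
`∫⁻ … ≤ c/log N₀`, then for every `c' > c`, frequently in `N` some length-`N` polynomial has
`∫⁻ … ≤ c'/log N` (along `N = N₀^{2^k}`). [cite: Burnol2002, Thm. 1.3] [cite: BDBLS2000, conjecture] -/
theorem frequently_rateBound_of_halfDoublingTail {H N₀ : ℕ} (hH : H ≤ N₀) (h2 : 2 ≤ N₀)
    (h : ∀ N : ℕ, H ≤ N →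
      (⨅ a : Fin (N ^ 2) → ℂ, ∫ t : ℝ, ‖1 - riemannZeta (1 / 2 + t * I) *
        ∑ n : Fin (N ^ 2), a n * ((n : ℂ) + 1) ^ (-(1 / 2 + t * I))‖ ^ 2 / (1 / 4 + t ^ 2)) ≤
      1 / 2 * (⨅ a : Fin N → ℂ, ∫ t : ℝ, ‖1 - riemannZeta (1 / 2 + t * I) *
        ∑ n : Fin N, a n * ((n : ℂ) + 1) ^ (-(1 / 2 + t * I))‖ ^ 2 / (1 / 4 + t ^ 2)))
    {c : ℝ} (a₀ : Fin N₀ → ℂ)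
    (hw : ∫⁻ t : ℝ, ENNReal.ofReal (‖1 - riemannZeta (1 / 2 + t * Complex.I) *
        ∑ n : Fin N₀, a₀ n * ((n : ℂ) + 1) ^ (-(1 / 2 + t * Complex.I))‖ ^ 2 / (1 / 4 + t ^ 2)) ≤
      ENNReal.ofReal (c / Real.log N₀))
    {c' : ℝ} (hc' : c < c') :
    ∃ᶠ N : ℕ in atTop, ∃ a : Fin N → ℂ, ∫⁻ t : ℝ, ENNReal.ofReal (‖1 - riemannZeta (1 / 2 + t * Complex.I) *
        ∑ n : Fin N, a n * ((n : ℂ) + 1) ^ (-(1 / 2 + t * Complex.I))‖ ^ 2 / (1 / 4 + t ^ 2)) ≤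
      ENNReal.ofReal (c' / Real.log N) := by
  set D : ℕ → ℝ := fun N ↦ ⨅ a : Fin N → ℂ, ∫ t : ℝ, ‖1 - riemannZeta (1 / 2 + t * I) *
        ∑ n : Fin N, a n * ((n : ℂ) + 1) ^ (-(1 / 2 + t * I))‖ ^ 2 / (1 / 4 + t ^ 2) with hD
  have hlog : 0 < Real.log N₀ := Real.log_pos (by exact_mod_cast h2)
  -- `c > 0`, from the BDBLS floor at level `N₀`
  have hc0 : 0 < c := by
    obtain ⟨C₀, hC₀, hfloor⟩ := nbIntegrand_lowerBound_two_le
    have h1 := (hfloor N₀ h2 a₀).trans hw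
    by_contra hle
    push Not at hle
    have h0 : ENNReal.ofReal (c / Real.log N₀) = 0 :=
      ENNReal.ofReal_of_nonpos (div_nonpos_of_nonpos_of_nonneg hle hlog.le)
    rw [h0, nonpos_iff_eq_zero, ENNReal.ofReal_eq_zero] at h1
    exact absurd h1 (not_le.2 (div_pos hC₀ hlog))
  -- the certificate in real form: `D N₀ * log N₀ ≤ c`
  have hD0 : D N₀ * Real.log N₀ ≤ c := by
    have h1 : D N₀ ≤ ∫ t : ℝ, ‖1 - riemannZeta (1 / 2 + t * I) *
        ∑ n : Fin N₀, a₀ n * ((n : ℂ) + 1) ^ (-(1 / 2 + t * I))‖ ^ 2 / (1 / 4 + t ^ 2) :=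
      ciInf_le (nb_bddBelow_range N₀) a₀
    have h2' : (∫ t : ℝ, ‖1 - riemannZeta (1 / 2 + t * I) *
        ∑ n : Fin N₀, a₀ n * ((n : ℂ) + 1) ^ (-(1 / 2 + t * I))‖ ^ 2 / (1 / 4 + t ^ 2)) ≤
        c / Real.log N₀ := by
      rw [nb_lintegral_eq_ofReal_integral a₀] at hw
      exact (ENNReal.ofReal_le_ofReal_iff (div_nonneg hc0.le hlog.le)).mp hw
    rw [← le_div_iff₀ hlog]
    exact h1.trans h2'
  have htower := tower_bound_of_halfDoubling D hH h2 h hD0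
  -- along the tower, some polynomial beats `c'/log N`
  rw [frequently_atTop]
  intro M
  refine ⟨N₀ ^ 2 ^ M, ?_, ?_⟩
  · calc M ≤ 2 ^ M := (Nat.lt_two_pow_self).le
      _ ≤ N₀ ^ M := Nat.pow_le_pow_left h2 M
      _ ≤ N₀ ^ 2 ^ M := Nat.pow_le_pow_right (by omega) (Nat.lt_two_pow_self).le
  · have hNk2 : 2 ≤ N₀ ^ 2 ^ M := h2.trans (Nat.le_self_pow (pow_ne_zero M two_ne_zero) N₀)
    have hlogk : 0 < Real.log ((N₀ ^ 2 ^ M : ℕ) : ℝ) := Real.log_pos (by exact_mod_cast hNk2)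
    have hlt : D (N₀ ^ 2 ^ M) < c' / Real.log ((N₀ ^ 2 ^ M : ℕ) : ℝ) := by
      rw [lt_div_iff₀ hlogk]
      exact (htower M).trans_lt hc'
    obtain ⟨a, ha⟩ := exists_lt_of_ciInf_lt hlt
    refine ⟨a, ?_⟩
    rw [nb_lintegral_eq_ofReal_integral a]
    exact ENNReal.ofReal_le_ofReal ha.le

/-! ## 3. The `θ = 1/2` doubling tail versus a finite certificate -/

/-- **`TailDoubling(1/2, H)` is refuted by ONE sub-`0.214` certificate.** If some level
`N₀ ≥ max(H,2)` carries a Dirichlet polynomial with `∫⁻ |1-ζA|²/(1/4+t²) ≤ c/log N₀` and `c < 0.214`,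
then `∀ N ≥ H, D(N²) ≤ D(N)/2` is false (tower + Burnol's floor over 58 certified zeros). The
`θ < 1/2` tails are false outright and the `θ < 1` tails give RH alone (tree); this is the boundary
case, reduced to a finite computation. [cite: Burnol2002, Thm. 1.3] [cite: BDBLS2000, conjecture] -/
theorem not_nb_halfDoublingTail_of_certificate {H N₀ : ℕ} (hH : H ≤ N₀) (h2 : 2 ≤ N₀) {c : ℝ}
    (hc : c < 214 / 1000) (a₀ : Fin N₀ → ℂ)
    (hw : ∫⁻ t : ℝ, ENNReal.ofReal (‖1 - riemannZeta (1 / 2 + t * Complex.I) *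
        ∑ n : Fin N₀, a₀ n * ((n : ℂ) + 1) ^ (-(1 / 2 + t * Complex.I))‖ ^ 2 / (1 / 4 + t ^ 2)) ≤
      ENNReal.ofReal (c / Real.log N₀)) :
    ¬ ∀ N : ℕ, H ≤ N →
      (⨅ a : Fin (N ^ 2) → ℂ, ∫ t : ℝ, ‖1 - riemannZeta (1 / 2 + t * I) *
        ∑ n : Fin (N ^ 2), a n * ((n : ℂ) + 1) ^ (-(1 / 2 + t * I))‖ ^ 2 / (1 / 4 + t ^ 2)) ≤
      1 / 2 * (⨅ a : Fin N → ℂ, ∫ t : ℝ, ‖1 - riemannZeta (1 / 2 + t * I) *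
        ∑ n : Fin N, a n * ((n : ℂ) + 1) ^ (-(1 / 2 + t * I))‖ ^ 2 / (1 / 4 + t ^ 2)) := by
  intro h
  have hfreq := frequently_rateBound_of_halfDoublingTail hH h2 h a₀ hw
    (c' := (c + 214 / 1000) / 2) (by linarith)
  have := lt_const_of_frequently_nbRateBound hfreq
  linarith

/-- **Abstract-certificate form.** The same with `0.214` replaced by Burnol's bound over ANY finite
set `T` of certified critical zeros: a certificate `c < 2π Σ_{ρ ∈ T} m_ρ²/|ρ|²` at one level
`N₀ ≥ max(H,2)` refutes the `θ = 1/2` tail (full sum `2π(2+γ-log 4π) = 0.29023`; Landreau–Richard's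
numerics put `I_min(N) log N ≈ 0.287` for `N ≤ 2·10⁴`, so `T` must carry `> 98.9 %` of the sum).
[cite: Burnol2002, Thm. 1.3 and Thm. 5.4] -/
theorem not_nb_halfDoublingTail_of_certificate_finset (T : Finset ℂ)
    (hT : ∀ ρ ∈ T, riemannZeta ρ = 0 ∧ ρ.re = 1 / 2) {H N₀ : ℕ} (hH : H ≤ N₀) (h2 : 2 ≤ N₀)
    {c : ℝ} (hc : c < 2 * π * ∑ ρ ∈ T, (riemannZetaZeroOrder ρ : ℝ) ^ 2 / ‖ρ‖ ^ 2)
    (a₀ : Fin N₀ → ℂ)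
    (hw : ∫⁻ t : ℝ, ENNReal.ofReal (‖1 - riemannZeta (1 / 2 + t * Complex.I) *
        ∑ n : Fin N₀, a₀ n * ((n : ℂ) + 1) ^ (-(1 / 2 + t * Complex.I))‖ ^ 2 / (1 / 4 + t ^ 2)) ≤
      ENNReal.ofReal (c / Real.log N₀)) :
    ¬ ∀ N : ℕ, H ≤ N →
      (⨅ a : Fin (N ^ 2) → ℂ, ∫ t : ℝ, ‖1 - riemannZeta (1 / 2 + t * I) *
        ∑ n : Fin (N ^ 2), a n * ((n : ℂ) + 1) ^ (-(1 / 2 + t * I))‖ ^ 2 / (1 / 4 + t ^ 2)) ≤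
      1 / 2 * (⨅ a : Fin N → ℂ, ∫ t : ℝ, ‖1 - riemannZeta (1 / 2 + t * I) *
        ∑ n : Fin N, a n * ((n : ℂ) + 1) ^ (-(1 / 2 + t * I))‖ ^ 2 / (1 / 4 + t ^ 2)) := by
  intro h
  set S : ℝ := 2 * π * ∑ ρ ∈ T, (riemannZetaZeroOrder ρ : ℝ) ^ 2 / ‖ρ‖ ^ 2 with hS
  have hfreq := frequently_rateBound_of_halfDoublingTail hH h2 h a₀ hw
    (c' := (c + S) / 2) (by linarith)
  have := two_pi_mul_sum_multSq_le_of_frequently_nbRateBound hfreq T hT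
  linarith

/-- **Contrapositive: the `θ = 1/2` tail predicts a per-level floor.** If `D(N²) ≤ D(N)/2` for all
`N ≥ H`, then EVERY Dirichlet polynomial of EVERY length `N ≥ max(H,2)` has
`0.214/log N ≤ ∫⁻ |1-ζA|²/(1/4+t²)` — an RH-free, level-by-level checkable consequence (the BDBLS
floor `nbIntegrand_lowerBound_two_le` gives only an unspecified `C₀ > 0`).
[cite: Burnol2002, Thm. 1.3] -/
theorem nb_levelFloor_of_halfDoublingTail {H : ℕ}
    (h : ∀ N : ℕ, H ≤ N →
      (⨅ a : Fin (N ^ 2) → ℂ, ∫ t : ℝ, ‖1 - riemannZeta (1 / 2 + t * I) *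
        ∑ n : Fin (N ^ 2), a n * ((n : ℂ) + 1) ^ (-(1 / 2 + t * I))‖ ^ 2 / (1 / 4 + t ^ 2)) ≤
      1 / 2 * (⨅ a : Fin N → ℂ, ∫ t : ℝ, ‖1 - riemannZeta (1 / 2 + t * I) *
        ∑ n : Fin N, a n * ((n : ℂ) + 1) ^ (-(1 / 2 + t * I))‖ ^ 2 / (1 / 4 + t ^ 2)))
    {N : ℕ} (hH : H ≤ N) (h2 : 2 ≤ N) (a : Fin N → ℂ) :
    ENNReal.ofReal (214 / 1000 / Real.log N) ≤
      ∫⁻ t : ℝ, ENNReal.ofReal (‖1 - riemannZeta (1 / 2 + t * Complex.I) *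
        ∑ n : Fin N, a n * ((n : ℂ) + 1) ^ (-(1 / 2 + t * Complex.I))‖ ^ 2 / (1 / 4 + t ^ 2)) := by
  by_contra hlt
  push Not at hlt
  have hlog : 0 < Real.log N := Real.log_pos (by exact_mod_cast h2)
  set Iv : ℝ≥0∞ := ∫⁻ t : ℝ, ENNReal.ofReal (‖1 - riemannZeta (1 / 2 + t * Complex.I) *
        ∑ n : Fin N, a n * ((n : ℂ) + 1) ^ (-(1 / 2 + t * Complex.I))‖ ^ 2 / (1 / 4 + t ^ 2)) with hIv
  have hfin : Iv ≠ ⊤ := (hlt.trans_le le_top).ne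
  set c : ℝ := Iv.toReal * Real.log N with hc
  have hIc : Iv = ENNReal.ofReal (c / Real.log N) := by
    rw [hc, mul_div_cancel_right₀ _ hlog.ne', ENNReal.ofReal_toReal hfin]
  have hclt : c < 214 / 1000 := by
    have h1 : Iv.toReal < 214 / 1000 / Real.log N := by
      have := (ENNReal.toReal_lt_toReal hfin ENNReal.ofReal_ne_top).mpr hlt
      rwa [ENNReal.toReal_ofReal (by positivity)] at this
    rw [hc, ← lt_div_iff₀ hlog]
    exact h1
  exact not_nb_halfDoublingTail_of_certificate hH h2 hclt a hIc.le h

end Summit.RiemannHypothesis.RiemannHypothesis.Theorems.Splittings.NbHalfDoubling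

end
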